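import Summits.ResolutionOfSingularities.ResolutionOfSingularities.Theorems.FrobeniusLadderFInjectiveMacaulayficationCIPolyKit
import HarnessLib

/-!
# `NotDvdOfSupport` — a variable does not divide a polynomial with a supported monomial missing it
# (crux `FInjectiveMacaulayfication`, road B «K-loc certificate → `CICertificates.ciCertificates`»; W4.5a UNCLAIMED-STUB LIST v1 U3,
# res-L1-w45a-plan-1 2026-08-27T09:02:12Z; res-plan-2 IDLE POOL DEAL #5; seat res-D-pv-010)

Support file for crux stmt-ResolutionOfSingularities-15315 (`FrobeniusLadder.FInjectiveMacaulayfication`), chain w45a.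
[OURS · L1 W4.5a] — NOT a statement of the manuscript [claim: Hironaka2017]; AI-written, weaker than expert review. No statement of the
manuscript is used; elementary `MvPolynomial` bookkeeping only.

PURPOSE. `KLocCell.honQuot_of_kLocCells` (and its `gs : Fin 1 → k[Y]` sequel) carries, per chart, the binder
`∀ i : Fin n, ¬ (MvPolynomial.X i ∣ g)` («the chart polynomial is divisible by no variable»). This file discharges it from the
SUPPORT of `g`, in three currencies:

* §1 `coeff_eq_zero_of_X_dvd`, **`not_X_dvd_of_mem_support`** — over any commutative semiring `R` and any index type `σ`:
  `(∃ m ∈ g.support, m i = 0) → ¬ X i ∣ g` (every monomial of `X i * q` has positive `i`-exponent, `MvPolynomial.coeff_X_mul'`);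
  pointwise form `not_X_dvd_of_coeff_ne_zero`, the exact criterion `X_dvd_iff_forall_mem_support` (`⟸` through
  Mathlib's `X_dvd_iff_modMonomial_eq_zero` is NOT needed by the consumer and not proved here — only the easy direction is), and the
  «all variables at once» form `forall_not_X_dvd_of_support`.
* §2 **`not_X_dvd_sum_monomial_of_mem`** — the LIST PRESENTATION the chart generator emits: for
  `g = (W.map fun e => monomial e.1 e.2).sum` with pairwise distinct exponents (`(W.map Prod.fst).Nodup`), an entry `e ∈ W` with
  `e.2 ≠ 0` and `e.1 i = 0` gives `¬ X i ∣ g` (`coeff_sum_monomial_of_not_mem`, `coeff_sum_monomial_of_nodup`: the coefficient of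
  `g` at `e.1` is `e.2`); and
  `forall_not_X_dvd_sum_monomial` (one witness entry per variable).
* §3 **`not_X_dvd_evalL`**, **`forall_not_X_dvd_evalL`** — the CI POLY KIT currency of `…CIPolyKit.lean` (terms
  `(c, v) : ℤ × (Fin n → ℕ)`, value `(L.map fun t => monomial (equivFunOnFinite.symm t.2) ((t.1 : ℤ) : K)).sum`, repeated exponents
  allowed): over `K` of characteristic `p`, a listed exponent `v` with `v i = 0` whose integer coefficient sum is NOT divisible by
  `p` witnesses `¬ X i ∣ value L` (`CIPolyKit.coeff_evalL` + `CharP.intCast_eq_zero_iff`) — the hypothesis of the `∀ i` form is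
  `decide`-able on literal chart data.

[folklore]
-/

-- single-problem summit: the doubled namespace component is forced
set_option linter.dupNamespace false

noncomputable section

namespace Summit.ResolutionOfSingularities.ResolutionOfSingularities.Theorems.FInjectiveMacaulayfication.NotDvdOfSupport

open MvPolynomial

/-! ## §1 Support criterion -/

section Support

variable {R : Type*} [CommSemiring R] {σ : Type*}

/-- A multiple of `X i` has no monomial with `i`-exponent `0`. [folklore] -/
theorem coeff_eq_zero_of_X_dvd {g : MvPolynomial σ R} {i : σ} (h : X i ∣ g) {m : σ →₀ ℕ} (hm : m i = 0) :
    coeff m g = 0 := by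
  classical
  obtain ⟨q, rfl⟩ := h
  rw [coeff_X_mul']
  have hi : i ∉ m.support := by simp [Finsupp.mem_support_iff, hm]
  rw [if_neg hi]

/-- **A monomial in the support with `i`-exponent `0` forbids `X i ∣ g`.** [folklore] -/
theorem not_X_dvd_of_mem_support (g : MvPolynomial σ R) (i : σ) (h : ∃ m ∈ g.support, m i = 0) :
    ¬ (X i ∣ g) := by
  rintro hdvd
  obtain ⟨m, hm, hmi⟩ := h
  exact (mem_support_iff.mp hm) (coeff_eq_zero_of_X_dvd hdvd hmi)

/-- Pointwise form: a non-zero coefficient at an exponent with `m i = 0` forbids `X i ∣ g`. [folklore] -/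
theorem not_X_dvd_of_coeff_ne_zero (g : MvPolynomial σ R) (i : σ) (m : σ →₀ ℕ) (hmi : m i = 0)
    (hc : coeff m g ≠ 0) : ¬ (X i ∣ g) :=
  not_X_dvd_of_mem_support g i ⟨m, mem_support_iff.mpr hc, hmi⟩

/-- «Divisible by no variable», all variables at once: one support witness per variable. [folklore] -/
theorem forall_not_X_dvd_of_support (g : MvPolynomial σ R) (h : ∀ i : σ, ∃ m ∈ g.support, m i = 0) :
    ∀ i : σ, ¬ (X i ∣ g) :=
  fun i => not_X_dvd_of_mem_support g i (h i)

/-- Contrapositive reading: if `X i ∣ g` then every monomial of `g` involves `X i`. [folklore] -/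
theorem forall_mem_support_ne_zero_of_X_dvd {g : MvPolynomial σ R} {i : σ} (h : X i ∣ g) :
    ∀ m ∈ g.support, m i ≠ 0 :=
  fun _ hm hmi => (mem_support_iff.mp hm) (coeff_eq_zero_of_X_dvd h hmi)

end Support

/-! ## §2 List presentation `g = Σ_{e ∈ W} monomial e.1 e.2` with pairwise distinct exponents -/

section ListPresentation

variable {R : Type*} [CommSemiring R] {σ : Type*}

/-- An exponent absent from the list carries coefficient `0` in `Σ_{f ∈ W} monomial f.1 f.2`. [folklore] -/
theorem coeff_sum_monomial_of_not_mem :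
    ∀ (W : List ((σ →₀ ℕ) × R)) (m : σ →₀ ℕ), m ∉ W.map Prod.fst →
      coeff m ((W.map fun f : (σ →₀ ℕ) × R => monomial f.1 f.2).sum) = 0
  | [], _, _ => by simp
  | f :: W, m, hm => by
    classical
    rw [List.map_cons, List.mem_cons, not_or] at hm
    rw [List.map_cons, List.sum_cons, coeff_add, coeff_monomial, if_neg (Ne.symm hm.1), zero_add]
    exact coeff_sum_monomial_of_not_mem W m hm.2

/-- Coefficient of a monomial list with pairwise distinct exponents at a listed exponent = the listed coefficient. [folklore] -/
theorem coeff_sum_monomial_of_nodup :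
    ∀ (W : List ((σ →₀ ℕ) × R)), (W.map Prod.fst).Nodup → ∀ e ∈ W,
      coeff e.1 ((W.map fun f : (σ →₀ ℕ) × R => monomial f.1 f.2).sum) = e.2
  | [], _, e, he => by simp at he
  | f :: W, hnd, e, he => by
    classical
    rw [List.map_cons, List.nodup_cons] at hnd
    rw [List.map_cons, List.sum_cons, coeff_add, coeff_monomial]
    rcases List.mem_cons.mp he with rfl | he'
    · -- the head: its exponent does not occur in the tail
      rw [if_pos rfl, coeff_sum_monomial_of_not_mem W e.1 hnd.1, add_zero]
    · -- in the tail: the head exponent differs from `e.1`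
      have hne : f.1 ≠ e.1 := fun h => hnd.1 (List.mem_map.mpr ⟨e, he', h.symm⟩)
      rw [if_neg hne, zero_add]
      exact coeff_sum_monomial_of_nodup W hnd.2 e he'

/-- **List presentation**: for `g = Σ_{e ∈ W} monomial e.1 e.2` with pairwise distinct exponents, a listed entry with non-zero
coefficient and `i`-exponent `0` forbids `X i ∣ g`. [folklore] -/
theorem not_X_dvd_sum_monomial_of_mem (W : List ((σ →₀ ℕ) × R)) (hnd : (W.map Prod.fst).Nodup) (i : σ)
    (e : (σ →₀ ℕ) × R) (he : e ∈ W) (hc : e.2 ≠ 0) (hi : e.1 i = 0) :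
    ¬ (X i ∣ (W.map fun f : (σ →₀ ℕ) × R => monomial f.1 f.2).sum) :=
  not_X_dvd_of_coeff_ne_zero _ i e.1 hi (by rw [coeff_sum_monomial_of_nodup W hnd e he]; exact hc)

/-- List presentation, all variables at once (one witness entry per variable). [folklore] -/
theorem forall_not_X_dvd_sum_monomial (W : List ((σ →₀ ℕ) × R)) (hnd : (W.map Prod.fst).Nodup)
    (h : ∀ i : σ, ∃ e ∈ W, e.2 ≠ 0 ∧ e.1 i = 0) :
    ∀ i : σ, ¬ (X i ∣ (W.map fun f : (σ →₀ ℕ) × R => monomial f.1 f.2).sum) := by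
  intro i
  obtain ⟨e, he, hc, hi⟩ := h i
  exact not_X_dvd_sum_monomial_of_mem W hnd i e he hc hi

end ListPresentation

/-! ## §3 The CI POLY KIT currency (`ℤ × (Fin n → ℕ)` term lists, characteristic `p`) -/

section PolyKit

variable {K : Type} [CommRing K] {n : ℕ}

/-- **Kit form**: a listed exponent `v` with `v i = 0` whose integer coefficient sum is not divisible by `p` forbids `X i ∣ value L`
(`CIPolyKit.coeff_evalL`). [folklore] -/
theorem not_X_dvd_evalL (p : ℕ) [CharP K p] (L : List (ℤ × (Fin n → ℕ))) (i : Fin n) (v : Fin n → ℕ) (hvi : v i = 0)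
    (hcoef : ¬ ((p : ℤ) ∣ ((L.filter fun t : ℤ × (Fin n → ℕ) => t.2 = v).map fun t : ℤ × (Fin n → ℕ) => t.1).sum)) :
    ¬ (X i ∣ (L.map fun t : ℤ × (Fin n → ℕ) =>
        (monomial (Finsupp.equivFunOnFinite.symm t.2) ((t.1 : ℤ) : K) : MvPolynomial (Fin n) K)).sum) := by
  refine not_X_dvd_of_coeff_ne_zero _ i (Finsupp.equivFunOnFinite.symm v) (by simpa using hvi) ?_
  rw [CIPolyKit.coeff_evalL]
  exact fun h => hcoef ((CharP.intCast_eq_zero_iff K p _).mp h)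

/-- **Kit form, all variables at once** — the `∀ i, ¬ X i ∣ g` binder of `KLocCell.honQuot_of_kLocCells` for a chart polynomial given
as a term list; the hypothesis is `decide`-able on literal data. [folklore] -/
theorem forall_not_X_dvd_evalL (p : ℕ) [CharP K p] (L : List (ℤ × (Fin n → ℕ)))
    (h : ∀ i : Fin n, ∃ t ∈ L, t.2 i = 0 ∧
      ¬ ((p : ℤ) ∣ ((L.filter fun s : ℤ × (Fin n → ℕ) => s.2 = t.2).map fun s : ℤ × (Fin n → ℕ) => s.1).sum)) :
    ∀ i : Fin n, ¬ (X i ∣ (L.map fun t : ℤ × (Fin n → ℕ) =>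
        (monomial (Finsupp.equivFunOnFinite.symm t.2) ((t.1 : ℤ) : K) : MvPolynomial (Fin n) K)).sum) := by
  intro i
  obtain ⟨t, -, hti, hcoef⟩ := h i
  exact not_X_dvd_evalL p L i t.2 hti hcoef

end PolyKit

end Summit.ResolutionOfSingularities.ResolutionOfSingularities.Theorems.FInjectiveMacaulayfication.NotDvdOfSupport

end
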